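import Literature.Analysis.Matrix.ConjugateGradientConvergence
import HarnessLib

/-!
# The preconditioned conjugate gradient recursion and its error identity
# `‖x − x_k‖_A² = γ̂_k z_kᵀr_k + ‖x − x_{k+1}‖_A²`: the lower bound `Σ_{j=k}^{k+d−1} γ̂_j z_jᵀr_j`
# and the two-sided estimate `Δ̂_k ≤ ‖x − x_k‖_A² ≤ κ(M⁻¹A) Δ̂_k`

Topic `Analysis/Matrix`; the preconditioned companion of `CGErrorEstimate.lean` (the Hestenes–Stiefel
recursion, `M = I`).  PUBLISHED RESULTS with our proofs; the only definitions are the algorithm's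
state and coefficients; no named fact (`def … : Prop`) (D-0026).

HONEST FRAMING: exact (Metropolis-corrected) sampling algorithms for lattice gauge theory; figures
of merit are autocorrelation/cost numbers at stated couplings and volumes; no continuum-physics claim.

## Source (read on the materialised text) and what is taken

G. Meurant, J. Papež, P. Tichý, *Accurate error estimation in CG*, Numer. Algorithms 88 (2021)
1337–1359 = arXiv:2101.03931 [MeurantPapezTichy2021] (held text `paper:arxiv-2101.03931`, p0007),
§4 "Preconditioning": **Algorithm 4** (Preconditioned Conjugate Gradients: "input `A`, `b`, `x₀`,
`M`; `r₀ = b − Ax₀`, `z₀ = M⁻¹r₀`, `p₀ = z₀`; for `k = 0, …`: `γ̂_k = z_kᵀr_k / p_kᵀAp_k`,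
`x_{k+1} = x_k + γ̂_k p_k`, `r_{k+1} = r_k − γ̂_k Ap_k`, Solve `M z_{k+1} = r_{k+1}`,
`δ̂_{k+1} = z_{k+1}ᵀr_{k+1} / z_kᵀr_k`, `p_{k+1} = z_{k+1} + δ̂_{k+1} p_k`"); "the PCG algorithm can
be seen as the standard CG algorithm applied to the preconditioned system `Âx̂ = b̂` …
`‖r̂_k‖² = r_kᵀM⁻¹r_k = z_kᵀr_k` and `‖x̂ − x̂_k‖²_Â = ‖x − x_k‖_A²` … In particular, (2.3) takes the
form **(4.1)** `ε_k = Δ̂_{k:k+d} + ε_{k+d+1}`, where **(4.2)** `Δ̂_{k:k+d} ≡ Σ_{j=k}^{k+d} γ̂_j z_jᵀr_j`.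
Therefore, in PCG we can compute the lower bounds using the PCG coefficients `γ̂_k` and inner
products `z_kᵀr_k` … Note that the safety factor `S` is now bounded by the condition number of the
preconditioned matrix; see Lemma 2."  (The PCG estimate goes back to Z. Strakoš, P. Tichý, BIT 45
(2005) 789–817, cited there as [StTi2005]; not re-read here.)

## What is formalised (`A`, `N : Matrix ι ι ℝ`, `N` playing `M⁻¹` — "Solve `Mz = r`" is `z = N r`;
## exact arithmetic; Lean's `x/0 = 0` makes the recursion total)

* `PCGState`, `pstepLength` (`γ̂`), `pcgStep`, `pcgState A N b x₀ k` (Algorithm 4), `pcgCoeff`,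
  `perrEstimate A N b x₀ k d = Σ_{j<d} γ̂_{k+j} z_{k+j}ᵀr_{k+j}` (`Δ̂`);
* `pcgState_r` (`r_k = b − Ax_k`), `pcgState_z` (`z_k = N r_k`);
* LOCAL ORTHOGONALITY (`A`, `N` symmetric positive definite): `pcgStep_local`, `pcgState_local`
  (`p_kᵀr_k = z_kᵀr_k`, `z_kᵀAp_k = p_kᵀAp_k`), `pcgState_z_succ_dotProduct_r` (`r_{k+1} ⊥_{M⁻¹} r_k`),
  `pcgState_p_dotProduct_r_succ`, `pcgState_p_succ_conj`, `pcgState_pAp_le_zAz`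
  (`p_kᵀAp_k ≤ z_kᵀAz_k`);
* **`aNormSq_error_eq_add`** — (4.1) with `d = 0`: `‖x − x_k‖_A² = γ̂_k z_kᵀr_k + ‖x − x_{k+1}‖_A²`;
  `pcgCoeff_mul_pos` (`γ̂_k z_kᵀr_k > 0` while `r_k ≠ 0`); `aNormSq_error_succ_le/_lt`;
* **`aNormSq_error_eq_perrEstimate_add`** ((4.1)), **`perrEstimate_le_aNormSq_error`** ((4.2): the
  computable LOWER bound), `perrEstimate_mono`;
* **`aNormSq_error_le_kappa_mul`** — Lemma 2 for PCG: if `αM ≤ A ≤ βM` in the two quadratic-form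
  readings `α·eᵀAe ≤ (Ae)ᵀN(Ae)` and `(Nr)ᵀA(Nr) ≤ β·rᵀNr` (the spectrum of `M⁻¹A` in `[α, β]`),
  then `‖x − x_k‖_A² ≤ (β/α)·γ̂_k z_kᵀr_k`: `Δ̂_k ≤ ε_k ≤ κ(M⁻¹A)Δ̂_k`;
* `pcgState_one_z` — `N = 1` is the unpreconditioned recursion (`z_k = r_k`).

NOT formalised: the change of variables `Â = L⁻¹AL⁻ᵀ` itself (we prove the identities directly
for Algorithm 4), global `M⁻¹`-orthogonality of the residuals and the Galerkin property in
`𝒦_m(M⁻¹A, z₀)`, finite precision.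

Context (cell pub-lqcd, HOME/R2-SCOPE.md §3 E5 / E7: every production solve of a fermion accept
step is preconditioned — even–odd, SAP, deflation, multigrid —; the certificate of
`CGErrorEstimate.lean` survives preconditioning with `‖r_k‖²` replaced by `z_kᵀr_k`, at no extra cost).
-/

noncomputable section

open scoped Matrix
open Finset

namespace Literature.Analysis.Matrix

namespace PreconditionedCG

open _root_.Matrix

variable {ι : Type*} [Fintype ι]

/-! ### Algorithm 4 (preconditioned conjugate gradients) -/

/-- The state `(x_k, r_k, z_k, p_k)` of PCG — iterate, residual, preconditioned residual
`z_k = M⁻¹r_k`, search direction. [cite: MeurantPapezTichy2021, §4 Algorithm 4] -/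
structure PCGState (ι : Type*) where
  /-- the iterate `x_k` -/
  x : ι → ℝ
  /-- the residual `r_k` -/
  r : ι → ℝ
  /-- the preconditioned residual `z_k = M⁻¹ r_k` -/
  z : ι → ℝ
  /-- the search direction `p_k` -/
  p : ι → ℝ

/-- The PCG step length `γ̂_k = z_kᵀr_k / p_kᵀAp_k` (`0` once `p_k = 0`, by `x/0 = 0`).
[cite: MeurantPapezTichy2021, §4 Algorithm 4] -/
def pstepLength (A : Matrix ι ι ℝ) (s : PCGState ι) : ℝ := (s.z ⬝ᵥ s.r) / (s.p ⬝ᵥ A *ᵥ s.p)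

/-- ONE PCG iteration (`pcgiter(k)`), with the preconditioner solve `Mz = r` written `z = N r`
(`N = M⁻¹`): `x' = x + γ̂p`, `r' = r − γ̂Ap`, `z' = N r'`, `δ̂ = z'ᵀr'/zᵀr`, `p' = z' + δ̂p`.
[cite: MeurantPapezTichy2021, §4 Algorithm 4] -/
def pcgStep (A N : Matrix ι ι ℝ) (s : PCGState ι) : PCGState ι where
  x := s.x + pstepLength A s • s.p
  r := s.r - pstepLength A s • A *ᵥ s.p
  z := N *ᵥ (s.r - pstepLength A s • A *ᵥ s.p)
  p := N *ᵥ (s.r - pstepLength A s • A *ᵥ s.p) +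
    ((N *ᵥ (s.r - pstepLength A s • A *ᵥ s.p) ⬝ᵥ (s.r - pstepLength A s • A *ᵥ s.p)) /
      (s.z ⬝ᵥ s.r)) • s.p

/-- The `k`-th PCG state from `x₀`: `r₀ = b − Ax₀`, `z₀ = N r₀`, `p₀ = z₀`.
[cite: MeurantPapezTichy2021, §4 Algorithm 4] -/
def pcgState (A N : Matrix ι ι ℝ) (b x₀ : ι → ℝ) : ℕ → PCGState ι
  | 0 => ⟨x₀, b - A *ᵥ x₀, N *ᵥ (b - A *ᵥ x₀), N *ᵥ (b - A *ᵥ x₀)⟩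
  | k + 1 => pcgStep A N (pcgState A N b x₀ k)

/-- The PCG coefficient `γ̂_k`. [cite: MeurantPapezTichy2021, §4 Algorithm 4] -/
def pcgCoeff (A N : Matrix ι ι ℝ) (b x₀ : ι → ℝ) (k : ℕ) : ℝ := pstepLength A (pcgState A N b x₀ k)

/-- The PCG error estimate with delay `d`: `Δ̂_{k:k+d−1} = Σ_{j<d} γ̂_{k+j} z_{k+j}ᵀr_{k+j}`.
[cite: MeurantPapezTichy2021, §4 eq. (4.2)] -/
def perrEstimate (A N : Matrix ι ι ℝ) (b x₀ : ι → ℝ) (k d : ℕ) : ℝ :=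
  ∑ j ∈ range d, pcgCoeff A N b x₀ (k + j) *
    ((pcgState A N b x₀ (k + j)).z ⬝ᵥ (pcgState A N b x₀ (k + j)).r)

section unfolding

variable (A N : Matrix ι ι ℝ) (b x₀ : ι → ℝ)

/-- `x_0 = x₀`. [cite: MeurantPapezTichy2021, §4 Algorithm 4] -/
@[simp] theorem pcgState_zero_x : (pcgState A N b x₀ 0).x = x₀ := rfl

/-- `r_0 = b − Ax₀`. [cite: MeurantPapezTichy2021, §4 Algorithm 4] -/
@[simp] theorem pcgState_zero_r : (pcgState A N b x₀ 0).r = b - A *ᵥ x₀ := rfl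

/-- `z_0 = N r_0`. [cite: MeurantPapezTichy2021, §4 Algorithm 4] -/
@[simp] theorem pcgState_zero_z : (pcgState A N b x₀ 0).z = N *ᵥ (b - A *ᵥ x₀) := rfl

/-- `p_0 = z_0`. [cite: MeurantPapezTichy2021, §4 Algorithm 4] -/
@[simp] theorem pcgState_zero_p : (pcgState A N b x₀ 0).p = N *ᵥ (b - A *ᵥ x₀) := rfl

/-- `x_{k+1} = x_k + γ̂_k p_k`. [cite: MeurantPapezTichy2021, §4 Algorithm 4] -/
theorem pcgState_succ_x (k : ℕ) :
    (pcgState A N b x₀ (k + 1)).x =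
      (pcgState A N b x₀ k).x + pcgCoeff A N b x₀ k • (pcgState A N b x₀ k).p := rfl

/-- `r_{k+1} = r_k − γ̂_k Ap_k`. [cite: MeurantPapezTichy2021, §4 Algorithm 4] -/
theorem pcgState_succ_r (k : ℕ) :
    (pcgState A N b x₀ (k + 1)).r =
      (pcgState A N b x₀ k).r - pcgCoeff A N b x₀ k • A *ᵥ (pcgState A N b x₀ k).p := rfl

/-- `z_{k+1} = N r_{k+1}` ("Solve `M z_{k+1} = r_{k+1}`"). [cite: MeurantPapezTichy2021, §4
Algorithm 4] -/
theorem pcgState_succ_z (k : ℕ) :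
    (pcgState A N b x₀ (k + 1)).z = N *ᵥ (pcgState A N b x₀ (k + 1)).r := rfl

/-- `p_{k+1} = z_{k+1} + δ̂_{k+1} p_k`, `δ̂_{k+1} = z_{k+1}ᵀr_{k+1}/z_kᵀr_k`. [cite: MeurantPapezTichy2021,
§4 Algorithm 4] -/
theorem pcgState_succ_p (k : ℕ) :
    (pcgState A N b x₀ (k + 1)).p = (pcgState A N b x₀ (k + 1)).z +
      (((pcgState A N b x₀ (k + 1)).z ⬝ᵥ (pcgState A N b x₀ (k + 1)).r) /
        ((pcgState A N b x₀ k).z ⬝ᵥ (pcgState A N b x₀ k).r)) • (pcgState A N b x₀ k).p := rfl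

/-- `Δ̂` with no term is `0`. [cite: MeurantPapezTichy2021, §4 eq. (4.2)] -/
@[simp] theorem perrEstimate_zero (k : ℕ) : perrEstimate A N b x₀ k 0 = 0 := by
  simp [perrEstimate]

/-- `Δ̂_{k:k+d} = Δ̂_{k:k+d−1} + γ̂_{k+d} z_{k+d}ᵀr_{k+d}`. [cite: MeurantPapezTichy2021, §4 eq. (4.2)] -/
theorem perrEstimate_succ (k d : ℕ) :
    perrEstimate A N b x₀ k (d + 1) = perrEstimate A N b x₀ k d +
      pcgCoeff A N b x₀ (k + d) *
        ((pcgState A N b x₀ (k + d)).z ⬝ᵥ (pcgState A N b x₀ (k + d)).r) := by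
  simp [perrEstimate, sum_range_succ]

/-- `z_k = N r_k` for every `k`. [cite: MeurantPapezTichy2021, §4 Algorithm 4] -/
theorem pcgState_z (k : ℕ) : (pcgState A N b x₀ k).z = N *ᵥ (pcgState A N b x₀ k).r := by
  cases k with
  | zero => rfl
  | succ k => rfl

end unfolding

/-! ### The residual invariant -/

/-- `r_k = b − Ax_k` for every `k` (exact arithmetic). [cite: MeurantPapezTichy2021, §4 with §2
("the recursively computed residual `r_k` corresponds with the true residual `b − Ax_k`")] -/
theorem pcgState_r (A N : Matrix ι ι ℝ) (b x₀ : ι → ℝ) (k : ℕ) :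
    (pcgState A N b x₀ k).r = b - A *ᵥ (pcgState A N b x₀ k).x := by
  induction k with
  | zero => rfl
  | succ k ih =>
    rw [pcgState_succ_r, pcgState_succ_x, ih, mulVec_add, mulVec_smul]
    abel

/-! ### Local orthogonality (`A` and `N = M⁻¹` symmetric positive definite) -/

/-- For real symmetric `A`: `(u, A w) = (w, A u)`. [folklore] -/
private theorem dotProduct_mulVec_comm' {A : Matrix ι ι ℝ} (hA : A.IsHermitian) (u w : ι → ℝ) :
    u ⬝ᵥ A *ᵥ w = w ⬝ᵥ A *ᵥ u := by
  rw [dotProduct_mulVec, ← mulVec_transpose, KyFan.transpose_eq hA, dotProduct_comm]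

/-- For positive definite `A`: `pᵀAp = 0 ⇒ p = 0`. [folklore] -/
private theorem eq_zero_of_dotProduct_mulVec_eq_zero {A : Matrix ι ι ℝ} (hA : A.PosDef)
    {p : ι → ℝ} (hp : p ⬝ᵥ A *ᵥ p = 0) : p = 0 := by
  by_contra hne
  have h := hA.dotProduct_mulVec_pos hne
  rw [star_trivial, hp] at h
  exact lt_irrefl 0 h

/-- **One step of local orthogonality for PCG.**  If `z = N r`, `pᵀr = zᵀr` and `zᵀAp = pᵀAp` at
state `s` (true at `k = 0`, `p₀ = z₀`), then after `s' = pcgiter(s)`: `z'ᵀr = 0` (`r' ⊥_{M⁻¹} r`),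
`pᵀr' = 0`, `p'ᵀAp = 0`, and again `p'ᵀr' = z'ᵀr'`, `z'ᵀAp' = p'ᵀAp'`.
[cite: MeurantPapezTichy2021, §4 ("the PCG algorithm can be seen as the standard CG algorithm
applied to the preconditioned system") with §2 proof of Lemma 2 (local orthogonality)] -/
theorem pcgStep_local {A N : Matrix ι ι ℝ} (hA : A.PosDef) (hN : N.PosDef) (s : PCGState ι)
    (hz : s.z = N *ᵥ s.r) (h₁ : s.p ⬝ᵥ s.r = s.z ⬝ᵥ s.r) (h₂ : s.z ⬝ᵥ A *ᵥ s.p = s.p ⬝ᵥ A *ᵥ s.p) :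
    (pcgStep A N s).z ⬝ᵥ s.r = 0 ∧ s.p ⬝ᵥ (pcgStep A N s).r = 0 ∧
      (pcgStep A N s).p ⬝ᵥ A *ᵥ s.p = 0 ∧
      (pcgStep A N s).p ⬝ᵥ (pcgStep A N s).r = (pcgStep A N s).z ⬝ᵥ (pcgStep A N s).r ∧
      (pcgStep A N s).z ⬝ᵥ A *ᵥ (pcgStep A N s).p = (pcgStep A N s).p ⬝ᵥ A *ᵥ (pcgStep A N s).p := by
  set γ := pstepLength A s with hγ
  set r' : ι → ℝ := s.r - γ • A *ᵥ s.p with hr'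
  set z' : ι → ℝ := N *ᵥ r' with hz'
  set δ := (z' ⬝ᵥ r') / (s.z ⬝ᵥ s.r) with hδ
  have hstep_r : (pcgStep A N s).r = r' := rfl
  have hstep_z : (pcgStep A N s).z = z' := rfl
  have hstep_p : (pcgStep A N s).p = z' + δ • s.p := rfl
  have hsymmA := dotProduct_mulVec_comm' hA.1
  have hsymmN := dotProduct_mulVec_comm' hN.1
  have hzr_eq : s.z ⬝ᵥ s.r = s.r ⬝ᵥ N *ᵥ s.r := by rw [hz, dotProduct_comm]
  -- key scalar fact: `γ · pᵀAp = zᵀr` unless `p = 0` (then `r = 0`)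
  have hγpAp : γ * (s.p ⬝ᵥ A *ᵥ s.p) = s.z ⬝ᵥ s.r ∨ (s.p = 0 ∧ s.r = 0) := by
    by_cases hp : s.p ⬝ᵥ A *ᵥ s.p = 0
    · right
      have hp0 := eq_zero_of_dotProduct_mulVec_eq_zero hA hp
      refine ⟨hp0, ?_⟩
      have h0 : s.r ⬝ᵥ N *ᵥ s.r = 0 := by rw [← hzr_eq, ← h₁, hp0, zero_dotProduct]
      exact eq_zero_of_dotProduct_mulVec_eq_zero hN h0
    · left
      rw [hγ, pstepLength, div_mul_cancel₀ _ hp]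
  -- (a) z' ⊥ r (`r'ᵀ M⁻¹ r = 0`)
  have ha : z' ⬝ᵥ s.r = 0 := by
    rw [hz', dotProduct_comm, hsymmN s.r r', ← hz, hr', sub_dotProduct, smul_dotProduct, smul_eq_mul,
      dotProduct_comm s.r s.z, dotProduct_comm (A *ᵥ s.p) s.z, h₂]
    rcases hγpAp with h | ⟨hp0, hr0⟩
    · rw [h, sub_self]
    · simp [hr0, hp0]
  -- (b) p ⊥ r'
  have hb : s.p ⬝ᵥ r' = 0 := by
    rw [hr', dotProduct_sub, dotProduct_smul, smul_eq_mul, h₁]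
    rcases hγpAp with h | ⟨hp0, hr0⟩
    · rw [h, sub_self]
    · simp [hr0, hp0]
  -- (c) p' ⊥_A p
  have hc : (z' + δ • s.p) ⬝ᵥ A *ᵥ s.p = 0 := by
    rw [add_dotProduct, smul_dotProduct, smul_eq_mul]
    by_cases hr0 : s.r = 0
    · have hzr0 : s.z ⬝ᵥ s.r = 0 := by rw [hr0, dotProduct_zero]
      have hγ0 : γ = 0 := by rw [hγ, pstepLength, hzr0, zero_div]
      have hr'0 : r' = 0 := by rw [hr', hr0, hγ0, zero_smul, sub_zero]
      have hz'0 : z' = 0 := by rw [hz', hr'0, mulVec_zero]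
      rw [hz'0, hδ, hz'0, zero_dotProduct, zero_dotProduct, zero_div, zero_mul, add_zero]
    · have hzr : s.z ⬝ᵥ s.r ≠ 0 := by
        intro h0
        rw [hzr_eq] at h0
        exact hr0 (eq_zero_of_dotProduct_mulVec_eq_zero hN h0)
      have hpAp : s.p ⬝ᵥ A *ᵥ s.p ≠ 0 := by
        intro h
        rcases hγpAp with h' | ⟨_, hr⟩
        · rw [h, mul_zero] at h'; exact hzr h'.symm
        · exact hr0 hr
      have hγne : γ ≠ 0 := by rw [hγ, pstepLength]; exact div_ne_zero hzr hpAp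
      have hAp : A *ᵥ s.p = γ⁻¹ • (s.r - r') := by
        rw [hr', sub_sub_cancel, smul_smul, inv_mul_cancel₀ hγne, one_smul]
      have h1 : z' ⬝ᵥ A *ᵥ s.p = -(z' ⬝ᵥ r') / γ := by
        rw [hAp, dotProduct_smul, smul_eq_mul, dotProduct_sub, ha, zero_sub]
        field_simp
      have h2 : δ * (s.p ⬝ᵥ A *ᵥ s.p) = (z' ⬝ᵥ r') / γ := by
        rw [hδ, hγ, pstepLength]
        field_simp
      rw [h1, h2]
      field_simp
      ring
  refine ⟨ha, hb, hc, ?_, ?_⟩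
  · -- (d) p'ᵀr' = z'ᵀr'
    rw [hstep_p, hstep_r, hstep_z, add_dotProduct, smul_dotProduct, smul_eq_mul, hb, mul_zero,
      add_zero]
  · -- (e) z'ᵀAp' = p'ᵀAp'
    rw [hstep_p, hstep_z]
    conv_rhs => rw [add_dotProduct, smul_dotProduct, smul_eq_mul, hsymmA s.p (z' + δ • s.p), hc,
      mul_zero, add_zero]

/-- The two local invariants hold at every PCG step: `p_kᵀr_k = z_kᵀr_k` and `z_kᵀAp_k = p_kᵀAp_k`.
[cite: MeurantPapezTichy2021, §4 with §2 (local orthogonality)] -/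
theorem pcgState_local {A N : Matrix ι ι ℝ} (hA : A.PosDef) (hN : N.PosDef) (b x₀ : ι → ℝ) (k : ℕ) :
    (pcgState A N b x₀ k).p ⬝ᵥ (pcgState A N b x₀ k).r =
        (pcgState A N b x₀ k).z ⬝ᵥ (pcgState A N b x₀ k).r ∧
      (pcgState A N b x₀ k).z ⬝ᵥ A *ᵥ (pcgState A N b x₀ k).p =
        (pcgState A N b x₀ k).p ⬝ᵥ A *ᵥ (pcgState A N b x₀ k).p := by
  induction k with
  | zero => exact ⟨rfl, rfl⟩
  | succ k ih =>
    obtain ⟨-, -, -, h₄, h₅⟩ :=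
      pcgStep_local hA hN (pcgState A N b x₀ k) (pcgState_z A N b x₀ k) ih.1 ih.2
    exact ⟨h₄, h₅⟩

/-- `z_{k+1}ᵀr_k = 0`: consecutive residuals are `M⁻¹`-orthogonal. [cite: MeurantPapezTichy2021, §4
("standard CG … applied to the preconditioned system": `r̂_{k+1} ⊥ r̂_k`)] -/
theorem pcgState_z_succ_dotProduct_r {A N : Matrix ι ι ℝ} (hA : A.PosDef) (hN : N.PosDef)
    (b x₀ : ι → ℝ) (k : ℕ) : (pcgState A N b x₀ (k + 1)).z ⬝ᵥ (pcgState A N b x₀ k).r = 0 :=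
  (pcgStep_local hA hN (pcgState A N b x₀ k) (pcgState_z A N b x₀ k) (pcgState_local hA hN b x₀ k).1
    (pcgState_local hA hN b x₀ k).2).1

/-- `p_kᵀr_{k+1} = 0` (exact line search). [cite: MeurantPapezTichy2021, §4 with §2] -/
theorem pcgState_p_dotProduct_r_succ {A N : Matrix ι ι ℝ} (hA : A.PosDef) (hN : N.PosDef)
    (b x₀ : ι → ℝ) (k : ℕ) : (pcgState A N b x₀ k).p ⬝ᵥ (pcgState A N b x₀ (k + 1)).r = 0 :=
  (pcgStep_local hA hN (pcgState A N b x₀ k) (pcgState_z A N b x₀ k) (pcgState_local hA hN b x₀ k).1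
    (pcgState_local hA hN b x₀ k).2).2.1

/-- Local `A`-conjugacy `p_{k+1}ᵀAp_k = 0`. [cite: MeurantPapezTichy2021, §4 with §2] -/
theorem pcgState_p_succ_conj {A N : Matrix ι ι ℝ} (hA : A.PosDef) (hN : N.PosDef) (b x₀ : ι → ℝ)
    (k : ℕ) : (pcgState A N b x₀ (k + 1)).p ⬝ᵥ A *ᵥ (pcgState A N b x₀ k).p = 0 :=
  (pcgStep_local hA hN (pcgState A N b x₀ k) (pcgState_z A N b x₀ k) (pcgState_local hA hN b x₀ k).1
    (pcgState_local hA hN b x₀ k).2).2.2.1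

/-- `p_kᵀAp_k ≤ z_kᵀAz_k` (`0 ≤ (z_k − p_k)ᵀA(z_k − p_k) = z_kᵀAz_k − p_kᵀAp_k`). [cite:
MeurantPapezTichy2021, §2 proof of Lemma 2 ("`p_kᵀAp_k ≤ r_kᵀAr_k` … local orthogonality") read
for Algorithm 4 (`r̂_k ↦ z_k`)] -/
theorem pcgState_pAp_le_zAz {A N : Matrix ι ι ℝ} (hA : A.PosDef) (hN : N.PosDef) (b x₀ : ι → ℝ)
    (k : ℕ) :
    (pcgState A N b x₀ k).p ⬝ᵥ A *ᵥ (pcgState A N b x₀ k).p ≤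
      (pcgState A N b x₀ k).z ⬝ᵥ A *ᵥ (pcgState A N b x₀ k).z := by
  set z := (pcgState A N b x₀ k).z
  set p := (pcgState A N b x₀ k).p
  have h₂ : z ⬝ᵥ A *ᵥ p = p ⬝ᵥ A *ᵥ p := (pcgState_local hA hN b x₀ k).2
  have hpsd := hA.posSemidef.dotProduct_mulVec_nonneg (z - p)
  rw [star_trivial, mulVec_sub, sub_dotProduct, dotProduct_sub, dotProduct_sub,
    dotProduct_mulVec_comm' hA.1 p z, h₂] at hpsd
  linarith

/-! ### The error identity (4.1) and the lower bound (4.2) -/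

/-- **(4.1) with `d = 0` — the PCG error identity**: if `Ax = b` then for every `k`
`‖x − x_k‖_A² = γ̂_k z_kᵀr_k + ‖x − x_{k+1}‖_A²`. [cite: MeurantPapezTichy2021, §4 eq. (4.1)
(`ε_k = Δ̂_{k:k+d} + ε_{k+d+1}`, `d = 0`) with §2 Lemma 1] -/
theorem aNormSq_error_eq_add {A N : Matrix ι ι ℝ} (hA : A.PosDef) (hN : N.PosDef) {b x₀ x : ι → ℝ}
    (hx : A *ᵥ x = b) (k : ℕ) :
    (x - (pcgState A N b x₀ k).x) ⬝ᵥ A *ᵥ (x - (pcgState A N b x₀ k).x) =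
      pcgCoeff A N b x₀ k * ((pcgState A N b x₀ k).z ⬝ᵥ (pcgState A N b x₀ k).r) +
        (x - (pcgState A N b x₀ (k + 1)).x) ⬝ᵥ A *ᵥ (x - (pcgState A N b x₀ (k + 1)).x) := by
  set s := pcgState A N b x₀ k with hs
  set γ := pcgCoeff A N b x₀ k with hγ
  rw [pcgState_succ_x]
  set e := x - s.x with he
  have hres : A *ᵥ e = s.r := by rw [he, mulVec_sub, hx, pcgState_r]
  have h₁ : s.p ⬝ᵥ s.r = s.z ⬝ᵥ s.r := (pcgState_local hA hN b x₀ k).1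
  have hsymm := dotProduct_mulVec_comm' hA.1
  have hx' : x - (s.x + γ • s.p) = e - γ • s.p := by rw [he]; abel
  have expand : (e - γ • s.p) ⬝ᵥ A *ᵥ (e - γ • s.p) =
      e ⬝ᵥ A *ᵥ e - 2 * γ * (s.p ⬝ᵥ A *ᵥ e) + γ ^ 2 * (s.p ⬝ᵥ A *ᵥ s.p) := by
    simp only [mulVec_sub, mulVec_smul, sub_dotProduct, dotProduct_sub, smul_dotProduct,
      dotProduct_smul, smul_eq_mul]
    rw [hsymm e s.p]
    ring
  rw [hx', expand, hres, h₁]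
  by_cases hp : s.p ⬝ᵥ A *ᵥ s.p = 0
  · have hp0 := eq_zero_of_dotProduct_mulVec_eq_zero hA hp
    have hzr0 : s.z ⬝ᵥ s.r = 0 := by rw [← h₁, hp0, zero_dotProduct]
    rw [hp, hzr0]; ring
  · have : γ * (s.p ⬝ᵥ A *ᵥ s.p) = s.z ⬝ᵥ s.r := by
      rw [hγ, pcgCoeff, ← hs, pstepLength, div_mul_cancel₀ _ hp]
    linear_combination (-γ) * this

/-- `z_kᵀr_k = r_kᵀ N r_k ≥ 0`. [cite: MeurantPapezTichy2021, §4 ("`‖r̂_k‖² = r_kᵀM⁻¹r_k = z_kᵀr_k`")] -/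
theorem pcgState_z_dotProduct_r_nonneg {A N : Matrix ι ι ℝ} (hN : N.PosDef) (b x₀ : ι → ℝ) (k : ℕ) :
    0 ≤ (pcgState A N b x₀ k).z ⬝ᵥ (pcgState A N b x₀ k).r := by
  rw [pcgState_z, dotProduct_comm]
  have h := hN.posSemidef.dotProduct_mulVec_nonneg (pcgState A N b x₀ k).r
  rwa [star_trivial] at h

/-- `γ̂_k ≥ 0`. [cite: MeurantPapezTichy2021, §4 Algorithm 4 with §2 Lemma 1] -/
theorem pcgCoeff_nonneg {A N : Matrix ι ι ℝ} (hA : A.PosDef) (hN : N.PosDef) (b x₀ : ι → ℝ)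
    (k : ℕ) : 0 ≤ pcgCoeff A N b x₀ k := by
  unfold pcgCoeff pstepLength
  refine div_nonneg (pcgState_z_dotProduct_r_nonneg hN b x₀ k) ?_
  have h := hA.posSemidef.dotProduct_mulVec_nonneg (pcgState A N b x₀ k).p
  rwa [star_trivial] at h

/-- **`γ̂_k z_kᵀr_k > 0` until the solution is found** (`r_k ≠ 0`). [cite: MeurantPapezTichy2021,
§2 Lemma 1 (`γ_k‖r_k‖² > 0`) read for Algorithm 4 (`‖r̂_k‖² = z_kᵀr_k`)] -/
theorem pcgCoeff_mul_pos {A N : Matrix ι ι ℝ} (hA : A.PosDef) (hN : N.PosDef) (b x₀ : ι → ℝ)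
    (k : ℕ) (hr : (pcgState A N b x₀ k).r ≠ 0) :
    0 < pcgCoeff A N b x₀ k * ((pcgState A N b x₀ k).z ⬝ᵥ (pcgState A N b x₀ k).r) := by
  set s := pcgState A N b x₀ k with hs
  have hzr : 0 < s.z ⬝ᵥ s.r := by
    rw [hs, pcgState_z, dotProduct_comm]
    have h := hN.dotProduct_mulVec_pos hr
    rwa [star_trivial] at h
  have h₁ : s.p ⬝ᵥ s.r = s.z ⬝ᵥ s.r := (pcgState_local hA hN b x₀ k).1
  have hp : s.p ≠ 0 := by
    intro hp; rw [hp, zero_dotProduct] at h₁; exact hzr.ne h₁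
  have hpAp : 0 < s.p ⬝ᵥ A *ᵥ s.p := by
    have h := hA.dotProduct_mulVec_pos hp; rwa [star_trivial] at h
  refine mul_pos ?_ hzr
  rw [pcgCoeff, ← hs, pstepLength]
  exact div_pos hzr hpAp

/-- `‖x − x_{k+1}‖_A² ≤ ‖x − x_k‖_A²`. [cite: MeurantPapezTichy2021, §2 Lemma 1 (2.2) with §4] -/
theorem aNormSq_error_succ_le {A N : Matrix ι ι ℝ} (hA : A.PosDef) (hN : N.PosDef)
    {b x₀ x : ι → ℝ} (hx : A *ᵥ x = b) (k : ℕ) :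
    (x - (pcgState A N b x₀ (k + 1)).x) ⬝ᵥ A *ᵥ (x - (pcgState A N b x₀ (k + 1)).x) ≤
      (x - (pcgState A N b x₀ k).x) ⬝ᵥ A *ᵥ (x - (pcgState A N b x₀ k).x) := by
  rw [aNormSq_error_eq_add hA hN hx k]
  have := mul_nonneg (pcgCoeff_nonneg hA hN b x₀ k) (pcgState_z_dotProduct_r_nonneg hN b x₀ k (A := A))
  linarith

/-- … strictly while `r_k ≠ 0`. [cite: MeurantPapezTichy2021, §2 Lemma 1 (2.2) with §4] -/
theorem aNormSq_error_succ_lt {A N : Matrix ι ι ℝ} (hA : A.PosDef) (hN : N.PosDef)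
    {b x₀ x : ι → ℝ} (hx : A *ᵥ x = b) (k : ℕ) (hr : (pcgState A N b x₀ k).r ≠ 0) :
    (x - (pcgState A N b x₀ (k + 1)).x) ⬝ᵥ A *ᵥ (x - (pcgState A N b x₀ (k + 1)).x) <
      (x - (pcgState A N b x₀ k).x) ⬝ᵥ A *ᵥ (x - (pcgState A N b x₀ k).x) := by
  rw [aNormSq_error_eq_add hA hN hx k]
  have := pcgCoeff_mul_pos hA hN b x₀ k hr
  linarith

/-- **(4.1)**: `‖x − x_k‖_A² = Σ_{j<d} γ̂_{k+j} z_{k+j}ᵀr_{k+j} + ‖x − x_{k+d}‖_A²`.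
[cite: MeurantPapezTichy2021, §4 eq. (4.1)] -/
theorem aNormSq_error_eq_perrEstimate_add {A N : Matrix ι ι ℝ} (hA : A.PosDef) (hN : N.PosDef)
    {b x₀ x : ι → ℝ} (hx : A *ᵥ x = b) (k d : ℕ) :
    (x - (pcgState A N b x₀ k).x) ⬝ᵥ A *ᵥ (x - (pcgState A N b x₀ k).x) =
      perrEstimate A N b x₀ k d +
        (x - (pcgState A N b x₀ (k + d)).x) ⬝ᵥ A *ᵥ (x - (pcgState A N b x₀ (k + d)).x) := by
  induction d with
  | zero => simp
  | succ d ih =>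
    rw [perrEstimate_succ, ih, aNormSq_error_eq_add hA hN hx (k + d), ← add_assoc k d 1]
    ring

/-- `Δ̂ ≥ 0`. [cite: MeurantPapezTichy2021, §4 eq. (4.2)] -/
theorem perrEstimate_nonneg {A N : Matrix ι ι ℝ} (hA : A.PosDef) (hN : N.PosDef) (b x₀ : ι → ℝ)
    (k d : ℕ) : 0 ≤ perrEstimate A N b x₀ k d :=
  sum_nonneg fun j _ => mul_nonneg (pcgCoeff_nonneg hA hN b x₀ (k + j))
    (pcgState_z_dotProduct_r_nonneg hN b x₀ (k + j))

/-- **(4.2) — the computable LOWER bound in PCG**: `Σ_{j<d} γ̂_{k+j} z_{k+j}ᵀr_{k+j} ≤ ‖x − x_k‖_A²`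
("still easy and cheap to evaluate"). [cite: MeurantPapezTichy2021, §4 eqs. (4.1)–(4.2) and the
following sentence] -/
theorem perrEstimate_le_aNormSq_error {A N : Matrix ι ι ℝ} (hA : A.PosDef) (hN : N.PosDef)
    {b x₀ x : ι → ℝ} (hx : A *ᵥ x = b) (k d : ℕ) :
    perrEstimate A N b x₀ k d ≤ (x - (pcgState A N b x₀ k).x) ⬝ᵥ A *ᵥ (x - (pcgState A N b x₀ k).x) := by
  rw [aNormSq_error_eq_perrEstimate_add hA hN hx k d]
  have h := hA.posSemidef.dotProduct_mulVec_nonneg (x - (pcgState A N b x₀ (k + d)).x)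
  rw [star_trivial] at h
  linarith

/-- The same bound for the `A`-norm of `ConjugateGradientConvergence.lean`. [cite: MeurantPapezTichy2021,
§4 eq. (4.2)] -/
theorem perrEstimate_le_aNorm_sq {A N : Matrix ι ι ℝ} (hA : A.PosDef) (hN : N.PosDef)
    {b x₀ x : ι → ℝ} (hx : A *ᵥ x = b) (k d : ℕ) :
    perrEstimate A N b x₀ k d ≤ ConjugateGradient.aNorm A (x - (pcgState A N b x₀ k).x) ^ 2 := by
  rw [ConjugateGradient.aNorm_sq hA.posSemidef]
  exact perrEstimate_le_aNormSq_error hA hN hx k d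

/-- More delay, larger bound. [cite: MeurantPapezTichy2021, §4 with §1] -/
theorem perrEstimate_mono {A N : Matrix ι ι ℝ} (hA : A.PosDef) (hN : N.PosDef) (b x₀ : ι → ℝ)
    (k : ℕ) {d d' : ℕ} (hdd : d ≤ d') : perrEstimate A N b x₀ k d ≤ perrEstimate A N b x₀ k d' := by
  unfold perrEstimate
  exact sum_le_sum_of_subset_of_nonneg (range_subset_range.mpr hdd) fun j _ _ =>
    mul_nonneg (pcgCoeff_nonneg hA hN b x₀ (k + j)) (pcgState_z_dotProduct_r_nonneg hN b x₀ (k + j))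

/-! ### Lemma 2 for PCG: `Δ̂_k ≤ ε_k ≤ κ(M⁻¹A) Δ̂_k` -/

/-- **LEMMA 2 for Algorithm 4**: if `αM ≤ A ≤ βM` (`0 < α`), written with `N = M⁻¹` as the two
quadratic-form inequalities `α·eᵀAe ≤ (Ae)ᵀN(Ae)` (all `e`) and `(Nr)ᵀA(Nr) ≤ β·rᵀNr` (all `r`) —
i.e. the spectrum of the preconditioned matrix `M⁻¹A` lies in `[α, β]` — then
`‖x − x_k‖_A² ≤ (β/α)·γ̂_k z_kᵀr_k`; with `perrEstimate_le_aNormSq_error` (`d = 1`):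
`Δ̂_k ≤ ε_k ≤ κ(M⁻¹A)·Δ̂_k` ("the safety factor is now bounded by the condition number of the
preconditioned matrix").  Proof as for Lemma 2: `Δ̂_k = (z_kᵀr_k)²/p_kᵀAp_k ≥ (z_kᵀr_k)²/z_kᵀAz_k
≥ z_kᵀr_k/β ≥ (α/β)‖x − x_k‖_A²`. [cite: MeurantPapezTichy2021, §4 (last sentence) with §2 Lemma 2] -/
theorem aNormSq_error_le_kappa_mul {A N : Matrix ι ι ℝ} (hA : A.PosDef) (hN : N.PosDef) {α β : ℝ}
    (hα : 0 < α) (hlow : ∀ e : ι → ℝ, α * (e ⬝ᵥ A *ᵥ e) ≤ (A *ᵥ e) ⬝ᵥ N *ᵥ (A *ᵥ e))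
    (hup : ∀ r : ι → ℝ, (N *ᵥ r) ⬝ᵥ A *ᵥ (N *ᵥ r) ≤ β * (r ⬝ᵥ N *ᵥ r)) {b x₀ x : ι → ℝ}
    (hx : A *ᵥ x = b) (k : ℕ) :
    (x - (pcgState A N b x₀ k).x) ⬝ᵥ A *ᵥ (x - (pcgState A N b x₀ k).x) ≤
      β / α * (pcgCoeff A N b x₀ k * ((pcgState A N b x₀ k).z ⬝ᵥ (pcgState A N b x₀ k).r)) := by
  set s := pcgState A N b x₀ k with hs
  set e := x - s.x with he
  have hres : A *ᵥ e = s.r := by rw [he, mulVec_sub, hx, pcgState_r]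
  have hz : s.z = N *ᵥ s.r := pcgState_z A N b x₀ k
  have hzr_eq : s.z ⬝ᵥ s.r = s.r ⬝ᵥ N *ᵥ s.r := by rw [hz, dotProduct_comm]
  -- the two spectral facts at the current vectors
  have hR1 : s.z ⬝ᵥ A *ᵥ s.z ≤ β * (s.z ⬝ᵥ s.r) := by rw [hzr_eq, hz]; exact hup s.r
  have hR2 : α * (e ⬝ᵥ A *ᵥ e) ≤ s.z ⬝ᵥ s.r := by rw [hzr_eq, ← hres]; exact hlow e
  have hAe : 0 ≤ e ⬝ᵥ A *ᵥ e := by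
    have := hA.posSemidef.dotProduct_mulVec_nonneg e; rwa [star_trivial] at this
  by_cases hr : s.r = 0
  · have h1 : α * (e ⬝ᵥ A *ᵥ e) ≤ 0 := by simpa [hr] using hR2
    have he0 : e ⬝ᵥ A *ᵥ e = 0 := by nlinarith
    rw [he0, hr, dotProduct_zero, mul_zero, mul_zero]
  have hzr : 0 < s.z ⬝ᵥ s.r := by
    rw [hzr_eq]; have h := hN.dotProduct_mulVec_pos hr; rwa [star_trivial] at h
  have hβ : 0 ≤ β := by
    -- `0 < zᵀr` and `zᵀAz ≥ 0` force `β ≥ 0` via `hR1` unless … use `pAp ≤ zAz`, `pAp > 0`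
    have h₁ : s.p ⬝ᵥ s.r = s.z ⬝ᵥ s.r := (pcgState_local hA hN b x₀ k).1
    have hp : s.p ≠ 0 := by
      intro hp; rw [hp, zero_dotProduct] at h₁; exact hzr.ne h₁
    have hpAp : 0 < s.p ⬝ᵥ A *ᵥ s.p := by
      have h := hA.dotProduct_mulVec_pos hp; rwa [star_trivial] at h
    have hzAz : 0 < s.z ⬝ᵥ A *ᵥ s.z := lt_of_lt_of_le hpAp (pcgState_pAp_le_zAz hA hN b x₀ k)
    nlinarith
  have h₁ : s.p ⬝ᵥ s.r = s.z ⬝ᵥ s.r := (pcgState_local hA hN b x₀ k).1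
  have hp : s.p ≠ 0 := by
    intro hp; rw [hp, zero_dotProduct] at h₁; exact hzr.ne h₁
  have hpAp : 0 < s.p ⬝ᵥ A *ᵥ s.p := by
    have h := hA.dotProduct_mulVec_pos hp; rwa [star_trivial] at h
  have hle : s.p ⬝ᵥ A *ᵥ s.p ≤ s.z ⬝ᵥ A *ᵥ s.z := pcgState_pAp_le_zAz hA hN b x₀ k
  have hzAz : 0 < s.z ⬝ᵥ A *ᵥ s.z := lt_of_lt_of_le hpAp hle
  have hγ : pcgCoeff A N b x₀ k = (s.z ⬝ᵥ s.r) / (s.p ⬝ᵥ A *ᵥ s.p) := rfl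
  rw [hγ]
  have step1 : e ⬝ᵥ A *ᵥ e ≤ (s.z ⬝ᵥ s.r) / α := by
    rw [le_div_iff₀ hα, mul_comm]; exact hR2
  have step2 : s.z ⬝ᵥ s.r ≤ β * ((s.z ⬝ᵥ s.r) / (s.p ⬝ᵥ A *ᵥ s.p) * (s.z ⬝ᵥ s.r)) := by
    have h3 : (s.z ⬝ᵥ s.r) / (s.z ⬝ᵥ A *ᵥ s.z) ≤ (s.z ⬝ᵥ s.r) / (s.p ⬝ᵥ A *ᵥ s.p) :=
      div_le_div_of_nonneg_left hzr.le hpAp hle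
    have h4 : s.z ⬝ᵥ s.r ≤ β * ((s.z ⬝ᵥ s.r) / (s.z ⬝ᵥ A *ᵥ s.z) * (s.z ⬝ᵥ s.r)) := by
      rw [div_mul_eq_mul_div, ← mul_div_assoc, le_div_iff₀ hzAz]
      nlinarith [hR1, hzr]
    calc s.z ⬝ᵥ s.r ≤ β * ((s.z ⬝ᵥ s.r) / (s.z ⬝ᵥ A *ᵥ s.z) * (s.z ⬝ᵥ s.r)) := h4
      _ ≤ β * ((s.z ⬝ᵥ s.r) / (s.p ⬝ᵥ A *ᵥ s.p) * (s.z ⬝ᵥ s.r)) :=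
          mul_le_mul_of_nonneg_left (mul_le_mul_of_nonneg_right h3 hzr.le) hβ
  calc e ⬝ᵥ A *ᵥ e ≤ (s.z ⬝ᵥ s.r) / α := step1
    _ ≤ β * ((s.z ⬝ᵥ s.r) / (s.p ⬝ᵥ A *ᵥ s.p) * (s.z ⬝ᵥ s.r)) / α :=
        div_le_div_of_nonneg_right step2 hα.le
    _ = β / α * ((s.z ⬝ᵥ s.r) / (s.p ⬝ᵥ A *ᵥ s.p) * (s.z ⬝ᵥ s.r)) := by ring

/-- The unpreconditioned recursion is the case `N = 1`: `pcgState A 1 b x₀ k` has `z_k = r_k`.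
[cite: MeurantPapezTichy2021, §4 ("The classical version … Algorithm 1" is `M = I`)] -/
theorem pcgState_one_z (A : Matrix ι ι ℝ) [DecidableEq ι] (b x₀ : ι → ℝ) (k : ℕ) :
    (pcgState A 1 b x₀ k).z = (pcgState A 1 b x₀ k).r := by
  rw [pcgState_z, one_mulVec]

end PreconditionedCG

end Literature.Analysis.Matrix
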